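import Mathlib
import Summits.Ventures.HodgeRepro.Tier4.Common.AdelicHaar
import Summits.Ventures.HodgeRepro.Tier4.Common.CompactOpenLevel
import Summits.Ventures.HodgeRepro.Tier4.Line1.RationalPoints
import Summits.Ventures.HodgeRepro.Tier4.Line1.C7BoxCompact
import Summits.Ventures.HodgeRepro.Tier4.Line4.FinitePartClosed
import Summits.Ventures.HodgeRepro.Tier4.Line4.TorusProduct
import Summits.Ventures.HodgeRepro.Tier4.Line4.ProperDefs
import Summits.Ventures.HodgeRepro.Tier4.Line4.CentralScalars
import Summits.Ventures.HodgeRepro.Tier4.Line4.OrbitBlocks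

/-!
# Tier4/Line4/OrbitProper — C-L4-PROPER: the orbit map `(b, b′) ↦ b⁻¹ γ₀,f b′` is PROPER modulo the diagonal centre

Blind re-derivation cell `pub-hodge-repro`, Tier 4 «PROVE THE STEP» (README §9–§10), LINE L4, cut C-L4-PROPER
(t4-plan-4 g3 S14566, statement S14602, binder `hdet` S14625), seat t4-L2-p3 (gen 4); module 4 of 4 (the assembly).

* the continuous maps `ψP`, `ψQ` from finite-adelic coordinates to the matrices `mixM 1 (Σ escF u_i (ε u_i′) P_i)`
  (`continuous_ψP`, `continuous_ψQ`), the finite part of a decomposition (`finM_decomp`);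
* `exists_torus_data`, `exists_torus_data'`: a torus element is `esc x₀ y₀ P₀ + esc x₁ y₁ P₁` with `x_i² + d y_i² = 1`;
* the four matrices of the normalised pair `(b z_f⁻¹, b′ z_f⁻¹)`, `z = esc x′_{j₁} y′_{j₁}`, as continuous images `ψP`/`ψQ`
  of the finite-part coordinates of the blocks (`mat_mul_ofFinPart_escGA_inv`, `mat_ofFinPart_escGA_mul_inv`);
* **`exists_compact_preimage_subset_mul_diagCentreFin`** (C-L4-PROPER): for `det B ≠ 0`, a row-genuine plane and a
  linearly regular rational `γ₀`, every compact `C ⊆ G(𝔸)` has a compact `C′ ⊆ T_f × T′_f` with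
  `{(b, b′) : b⁻¹ γ₀,f b′ ∈ C} ⊆ C′ · Δ(Z_f)`; `…_of_isDefinite` = the same under the line's `hW : IsDefinite W`
  (`det_ne_zero_of_isDefinite`);
* the TREE's predicate `HasProperFinOrbit` (L2-p1's ProperDefs p697453 = Integ-Concat-v2 L485; imported, not restated)
  holds: `hasProperFinOrbit_of_isLinRegular` (`hdet`) and `hasProperFinOrbit_of_isDefinite` (`hW`).

WHY `det B ≠ 0` (junk test, S14602/S14625): for `B = 0` every field of `IsGenuineRow` and `IsLinRegular` can hold while
`T = (E′^×)²` carries no norm condition and the statement is FALSE; the load-bearing fact is the norm-one condition of the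
line scalars (`nrm_eq_one_of_unitary`).

Mathlib + the line's landed modules only; no printed input; nothing here asserts anything about the truth of (P);
HC_CM is NOT proved by anyone in this repository.
-/

set_option autoImplicit false

noncomputable section

namespace Summit.Ventures.HodgeRepro.Tier4.Line4

open Summit.Ventures.HodgeRepro.Tier4 Summit.Ventures.HodgeRepro.Tier4.Common
  Summit.Ventures.HodgeRepro.Tier4.Line1 Matrix NumberField IsDedekindDomain
open scoped Pointwise NumberField

variable {k : Type} [Field k] [NumberField k] (W : PlaneData k)

/-! ## 10. The finite part of a decomposition -/

section Algebra

/-- the finite part of a decomposition -/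
theorem finM_decomp (P : Fin 2 → Matrix (Fin 4) (Fin 4) k) (a₀ b₀ a₁ b₁ : Ad k) :
    finM k (esc W a₀ b₀ * adMat k (P 0) + esc W a₁ b₁ * adMat k (P 1)) =
      escF W (finPart k a₀) (finPart k b₀) * finM k (adMat k (P 0)) +
        escF W (finPart k a₁) (finPart k b₁) * finM k (adMat k (P 1)) := by
  rw [finM_add, finM_mul, finM_mul, finM_esc, finM_esc]

end Algebra

/-! ## 10′. Coordinates → matrices, continuously -/

section Maps

/-- the coordinates of `esc s * esc t̄` (`(s₀ t₀ + d s₁ t₁, −(s₀ t₁ − s₁ t₀))`) -/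
def μc (d : k) (s t : Fin 2 → FiniteAdeleRing (𝓞 k) k) : Fin 2 → FiniteAdeleRing (𝓞 k) k :=
  ![s 0 * t 0 + algebraMap k (FiniteAdeleRing (𝓞 k) k) d * (s 1 * t 1), -(s 0 * t 1 - s 1 * t 0)]

/-- `μc` is continuous in both arguments -/
theorem continuous_μc_comp (d : k) {X : Type} [TopologicalSpace X] {f g : X → Fin 2 → FiniteAdeleRing (𝓞 k) k}
    (hf : Continuous f) (hg : Continuous g) : Continuous fun x => μc d (f x) (g x) := by
  refine continuous_pi fun i => ?_
  have hf0 : Continuous fun x => f x 0 := (continuous_apply 0).comp hf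
  have hf1 : Continuous fun x => f x 1 := (continuous_apply 1).comp hf
  have hg0 : Continuous fun x => g x 0 := (continuous_apply 0).comp hg
  have hg1 : Continuous fun x => g x 1 := (continuous_apply 1).comp hg
  fin_cases i
  · show Continuous fun x => f x 0 * g x 0 + algebraMap k (FiniteAdeleRing (𝓞 k) k) d * (f x 1 * g x 1)
    exact (hf0.mul hg0).add (continuous_const.mul (hf1.mul hg1))
  · show Continuous fun x => -(f x 0 * g x 1 - f x 1 * g x 0)
    exact ((hf0.mul hg1).sub (hf1.mul hg0)).neg

/-- `escF` is continuous in its two coordinates -/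
theorem continuous_escF_comp {X : Type} [TopologicalSpace X] {f g : X → FiniteAdeleRing (𝓞 k) k}
    (hf : Continuous f) (hg : Continuous g) : Continuous fun x => escF W (f x) (g x) := by
  simp only [escF]
  exact (hf.smul continuous_const).add (hg.smul continuous_const)

/-- `N ↦ mixM 1 N` is continuous -/
theorem continuous_mixM_one_comp {X : Type} [TopologicalSpace X]
    {f : X → Matrix (Fin 4) (Fin 4) (FiniteAdeleRing (𝓞 k) k)} (hf : Continuous f) :
    Continuous fun x => mixM k 1 (f x) := by
  refine continuous_matrix fun i j => ?_
  exact continuous_const.prodMk ((continuous_apply j).comp ((continuous_apply i).comp hf))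

/-- the matrix `mixM 1 (escF u₀ (ε u₀′) P₀ + escF u₁ (ε u₁′) P₁)` of a pair of coordinates (`ε = ±1`: conjugated or not) -/
def ψP (P : Fin 2 → Matrix (Fin 4) (Fin 4) k) (ε : FiniteAdeleRing (𝓞 k) k)
    (u : (Fin 2 → FiniteAdeleRing (𝓞 k) k) × (Fin 2 → FiniteAdeleRing (𝓞 k) k)) : M4 k :=
  mixM k 1 (escF W (u.1 0) (ε * u.1 1) * finM k (adMat k (P 0)) + escF W (u.2 0) (ε * u.2 1) * finM k (adMat k (P 1)))

/-- `ψP` is continuous -/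
theorem continuous_ψP (P : Fin 2 → Matrix (Fin 4) (Fin 4) k) (ε : FiniteAdeleRing (𝓞 k) k) :
    Continuous (ψP W P ε) := by
  have h10 : Continuous fun u : (Fin 2 → FiniteAdeleRing (𝓞 k) k) × (Fin 2 → FiniteAdeleRing (𝓞 k) k) => u.1 0 :=
    (continuous_apply 0).comp continuous_fst
  have h11 : Continuous fun u : (Fin 2 → FiniteAdeleRing (𝓞 k) k) × (Fin 2 → FiniteAdeleRing (𝓞 k) k) => u.1 1 :=
    (continuous_apply 1).comp continuous_fst
  have h20 : Continuous fun u : (Fin 2 → FiniteAdeleRing (𝓞 k) k) × (Fin 2 → FiniteAdeleRing (𝓞 k) k) => u.2 0 :=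
    (continuous_apply 0).comp continuous_snd
  have h21 : Continuous fun u : (Fin 2 → FiniteAdeleRing (𝓞 k) k) × (Fin 2 → FiniteAdeleRing (𝓞 k) k) => u.2 1 :=
    (continuous_apply 1).comp continuous_snd
  exact continuous_mixM_one_comp
    (((continuous_escF_comp W h10 (continuous_const.mul h11)).matrix_mul continuous_const).add
      ((continuous_escF_comp W h20 (continuous_const.mul h21)).matrix_mul continuous_const))

/-- the matrix of the products `esc s_j * esc t̄` on the two `Q`-lines -/
def ψQ (d : k) (ε : FiniteAdeleRing (𝓞 k) k)
    (u : ((Fin 2 → FiniteAdeleRing (𝓞 k) k) × (Fin 2 → FiniteAdeleRing (𝓞 k) k)) × (Fin 2 → FiniteAdeleRing (𝓞 k) k)) :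
    M4 k :=
  ψP W W.Q ε ((μc d u.1.1 u.2, μc d u.1.2 u.2))

/-- `ψQ` is continuous -/
theorem continuous_ψQ (d : k) (ε : FiniteAdeleRing (𝓞 k) k) : Continuous (ψQ W d ε) := by
  have h1 : Continuous fun u : ((Fin 2 → FiniteAdeleRing (𝓞 k) k) × (Fin 2 → FiniteAdeleRing (𝓞 k) k)) ×
      (Fin 2 → FiniteAdeleRing (𝓞 k) k) => μc d u.1.1 u.2 :=
    continuous_μc_comp d (continuous_fst.comp continuous_fst) continuous_snd
  have h2 : Continuous fun u : ((Fin 2 → FiniteAdeleRing (𝓞 k) k) × (Fin 2 → FiniteAdeleRing (𝓞 k) k)) ×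
      (Fin 2 → FiniteAdeleRing (𝓞 k) k) => μc d u.1.2 u.2 :=
    continuous_μc_comp d (continuous_snd.comp continuous_fst) continuous_snd
  exact (continuous_ψP W W.Q ε).comp (h1.prodMk h2)

end Maps

/-! ## 10″. The four matrices of the normalised pair -/

section Normalised

/-- `mat (b · z_f⁻¹)` for `z = esc x′ y′` (norm one), `b ∈ G(𝔸_f)` with `mat b = Σ esc x_i y_i P_i` -/
theorem mat_mul_ofFinPart_escGA_inv {d : k} (hΩ : W.Ω * W.Ω = -(d • (1 : Matrix (Fin 4) (Fin 4) k)))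
    (hΩB : W.Ω * W.B = -(W.B * W.Ωᵀ)) (P : Fin 2 → Matrix (Fin 4) (Fin 4) k) (hPΩ : ∀ i, P i * W.Ω = W.Ω * P i)
    (x y : Fin 2 → Ad k) {b : GA W} (hbf : b ∈ finitePart W)
    (hb : GA.mat W b = esc W (x 0) (y 0) * adMat k (P 0) + esc W (x 1) (y 1) * adMat k (P 1))
    (x' y' : Ad k) (h : nrm d x' y' = 1) :
    GA.mat W (b * (GA.ofFinPart W (escGA W hΩ hΩB x' y' h))⁻¹) =
      ψP W P (-1) (![finPart k (x 0 * x' + algebraMap k (Ad k) d * (y 0 * y')), finPart k (x 0 * y' - y 0 * x')],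
        ![finPart k (x 1 * x' + algebraMap k (Ad k) d * (y 1 * y')), finPart k (x 1 * y' - y 1 * x')]) := by
  rw [GA.mat_mul, ← ofFinPart_inv, GA.mat_ofFinPart, mat_escGA_inv]
  apply M4_ext
  · rw [infM_mul, infM_mixM, mul_one, (mem_finitePart_iff_infM W b).1 hbf]
    simp only [ψP, infM_mixM]
  · rw [finM_mul, finM_mixM, ← finM_mul, hb, decomp_mul_esc W hΩ P hPΩ, finM_decomp]
    simp only [ψP, finM_mixM, Matrix.cons_val_zero, Matrix.cons_val_one, map_neg, neg_one_mul]

/-- `mat (z_f · b⁻¹)` for `z = esc x′ y′` (norm one), `b ∈ G(𝔸_f)` with `mat b⁻¹ = Σ esc x_i (−y_i) P_i` -/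
theorem mat_ofFinPart_escGA_mul_inv {d : k} (hΩ : W.Ω * W.Ω = -(d • (1 : Matrix (Fin 4) (Fin 4) k)))
    (hΩB : W.Ω * W.B = -(W.B * W.Ωᵀ)) (P : Fin 2 → Matrix (Fin 4) (Fin 4) k)
    (x y : Fin 2 → Ad k) {b : GA W} (hbf : b ∈ finitePart W)
    (hbinv : GA.mat W b⁻¹ = esc W (x 0) (-y 0) * adMat k (P 0) + esc W (x 1) (-y 1) * adMat k (P 1))
    (x' y' : Ad k) (h : nrm d x' y' = 1) :
    GA.mat W (GA.ofFinPart W (escGA W hΩ hΩB x' y' h) * b⁻¹) =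
      ψP W P 1 (![finPart k (x 0 * x' + algebraMap k (Ad k) d * (y 0 * y')), finPart k (x 0 * y' - y 0 * x')],
        ![finPart k (x 1 * x' + algebraMap k (Ad k) d * (y 1 * y')), finPart k (x 1 * y' - y 1 * x')]) := by
  rw [GA.mat_mul, GA.mat_ofFinPart, mat_escGA]
  apply M4_ext
  · rw [infM_mul, infM_mixM, one_mul, (mem_finitePart_iff_infM W _).1 (inv_mem hbf)]
    simp only [ψP, infM_mixM]
  · rw [finM_mul, finM_mixM, ← finM_mul, hbinv, esc_mul_decomp_conj W hΩ P, finM_decomp]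
    simp only [ψP, finM_mixM, Matrix.cons_val_zero, Matrix.cons_val_one, one_mul]

end Normalised

/-! ## 11. C-L4-PROPER -/

section Main

/-- the data of a torus element: a pair of norm-one line scalars -/
theorem exists_torus_data {d : k} (hΩ : W.Ω * W.Ω = -(d • (1 : Matrix (Fin 4) (Fin 4) k))) (hd : ¬ IsSquare (-d))
    (hΩB : W.Ω * W.B = -(W.B * W.Ωᵀ)) (hdet : W.B.det ≠ 0) (hPB : ∀ i, W.P i * W.B = W.B * (W.P i)ᵀ)
    (hPr : ∀ i, (W.P i).rank = 2) {b : GA W} (hb : b ∈ torusT W) :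
    ∃ x y : Fin 2 → Ad k, GA.mat W b = esc W (x 0) (y 0) * adMat k (W.P 0) + esc W (x 1) (y 1) * adMat k (W.P 1) ∧
      ∀ i, nrm d (x i) (y i) = 1 := by
  have hΩ' : GA.mat W b * adMat k W.Ω = adMat k W.Ω * GA.mat W b := ((mem_unitaryGroup W _).1 b.2).1
  have hunit : GA.mat W b * adMat k W.B * (GA.mat W b)ᵀ = adMat k W.B := ((mem_unitaryGroup W _).1 b.2).2
  have hP : ∀ i, GA.mat W b * adMat k (W.P i) = adMat k (W.P i) * GA.mat W b := by
    intro i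
    fin_cases i
    · exact (Subgroup.mem_inf.1 hb).1
    · exact (Subgroup.mem_inf.1 hb).2
  obtain ⟨x, y, hxy⟩ := exists_esc_decomp W hΩ hd W.P W.P_comm hPr W.P_sum hΩ' hP
  exact ⟨x, y, hxy, fun i => nrm_eq_one_of_unitary W hΩ hΩB hdet W.P W.P_comm hPB W.P_idem hPr W.P_sum x y hxy hunit i⟩

/-- the data of a `T′`-element -/
theorem exists_torus_data' {d : k} (hΩ : W.Ω * W.Ω = -(d • (1 : Matrix (Fin 4) (Fin 4) k))) (hd : ¬ IsSquare (-d))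
    (hΩB : W.Ω * W.B = -(W.B * W.Ωᵀ)) (hdet : W.B.det ≠ 0) (hQB : ∀ j, W.Q j * W.B = W.B * (W.Q j)ᵀ)
    (hQr : ∀ j, (W.Q j).rank = 2) {b : GA W} (hb : b ∈ torusT' W) :
    ∃ x y : Fin 2 → Ad k, GA.mat W b = esc W (x 0) (y 0) * adMat k (W.Q 0) + esc W (x 1) (y 1) * adMat k (W.Q 1) ∧
      ∀ j, nrm d (x j) (y j) = 1 := by
  have hΩ' : GA.mat W b * adMat k W.Ω = adMat k W.Ω * GA.mat W b := ((mem_unitaryGroup W _).1 b.2).1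
  have hunit : GA.mat W b * adMat k W.B * (GA.mat W b)ᵀ = adMat k W.B := ((mem_unitaryGroup W _).1 b.2).2
  have hQ : ∀ j, GA.mat W b * adMat k (W.Q j) = adMat k (W.Q j) * GA.mat W b := by
    intro j
    fin_cases j
    · exact (Subgroup.mem_inf.1 hb).1
    · exact (Subgroup.mem_inf.1 hb).2
  obtain ⟨x, y, hxy⟩ := exists_esc_decomp W hΩ hd W.Q W.Q_comm hQr W.Q_sum hΩ' hQ
  exact ⟨x, y, hxy, fun j => nrm_eq_one_of_unitary W hΩ hΩB hdet W.Q W.Q_comm hQB W.Q_idem hQr W.Q_sum x y hxy hunit j⟩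

/-- the finite part of the matrix of `b⁻¹ γ_f b′` is that of `b⁻¹ γ b′` -/
theorem finM_mat_ofFinPart_mid (b γ b' : GA W) :
    finM k (GA.mat W (b⁻¹ * GA.ofFinPart W γ * b')) = finM k (GA.mat W (b⁻¹ * γ * b')) := by
  simp only [GA.mat_mul, finM_mul, GA.mat_ofFinPart, finM_mixM]

/-- **C-L4-PROPER — the orbit map is PROPER modulo the diagonal centre** (plan-4 g3 S14566, binder `hdet` S14625): for a plane
with `det B ≠ 0` (a definite plane has it, `det_ne_zero_of_isDefinite`), row-genuine, and a linearly regular rational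
`γ₀` (the binders `hdet`/`hW`, `hg`, `hreg` of the line), every compact `C ⊆ G(𝔸)` has a
compact `C′ ⊆ T_f × T′_f` with `{(b, b′) : b⁻¹ γ₀,f b′ ∈ C} ⊆ C′ · Δ(Z_f)` — the closed-orbit / proper-orbit-map fact
behind the convergence of the regular relative orbital integrals, at the finite places.  Consumers: FINSUM's `hint`
(compact support of the integrand on `DZ_f × T′_f` once `DZ_f ∩ C·Z_f` is relatively compact, FundamentalDomainSaturation
p695146) and `hpos` (FINPOS′ on the compact closure). -/
theorem exists_compact_preimage_subset_mul_diagCentreFin (hdet : W.B.det ≠ 0) (hg : Line1.IsGenuineRow W)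
    (γ₀ : rationalPoints W) (hreg : Line1.IsLinRegular W γ₀) (C : Set (GA W)) (hC : IsCompact C) :
    ∃ C' : Set (torusFin W × torusFin' W), IsCompact C' ∧
      {p : torusFin W × torusFin' W |
        (((p.1 : torusT W) : GA W))⁻¹ * GA.ofFinPart W (γ₀ : GA W) * ((p.2 : torusT' W) : GA W) ∈ C} ⊆
        C' * diagCentreFin W := by
  obtain ⟨⟨d, hΩ, hd⟩, hΩB, hPB, hQB, hPr, hQr⟩ := hg
  obtain ⟨g₀, hg₀⟩ := exists_adMat_eq_mat W γ₀
  have hg₀Ω : g₀ * W.Ω = W.Ω * g₀ := by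
    apply adMat_injective
    rw [adMat_mul, adMat_mul, hg₀]
    exact ((mem_unitaryGroup W _).1 (γ₀ : GA W).2).1
  obtain ⟨⟨i₁, hi₁⟩, ⟨j₁, hj₁⟩⟩ := exists_common_neighbour W hΩ hd hPr hQr γ₀ hreg hg₀
  -- the compact coordinate sets: `Kp i` for the block `(i, j₁)`, `Kq j` for the block `(i₁, j)`
  choose Kp hKpc hKp using fun i => exists_compact_coords W hΩ hd (hj₁ i) (W.P i) (W.Q j₁) C hC
  choose Kq hKqc hKq using fun j => exists_compact_coords W hΩ hd (hi₁ j) (W.P i₁) (W.Q j) C hC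
  -- the compact sets of matrices and the compact set `C′`
  set K1 := ψP W W.P (-1) '' (Kp 0 ×ˢ Kp 1) with hK1
  set K1' := ψP W W.P 1 '' (Kp 0 ×ˢ Kp 1) with hK1'
  set K2 := ψQ W d 1 '' ((Kq 0 ×ˢ Kq 1) ×ˢ Kq j₁) with hK2
  set K2' := ψQ W d (-1) '' ((Kq 0 ×ˢ Kq 1) ×ˢ Kq j₁) with hK2'
  have hK1c : IsCompact K1 := ((hKpc 0).prod (hKpc 1)).image (continuous_ψP W W.P (-1))
  have hK1'c : IsCompact K1' := ((hKpc 0).prod (hKpc 1)).image (continuous_ψP W W.P 1)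
  have hK2c : IsCompact K2 := (((hKqc 0).prod (hKqc 1)).prod (hKqc j₁)).image (continuous_ψQ W d 1)
  have hK2'c : IsCompact K2' := (((hKqc 0).prod (hKqc 1)).prod (hKqc j₁)).image (continuous_ψQ W d (-1))
  set E₁ : Set (GA W) := {g | GA.mat W g ∈ K1 ∧ GA.mat W g⁻¹ ∈ K1'} with hE₁
  set E₂ : Set (GA W) := {g | GA.mat W g ∈ K2 ∧ GA.mat W g⁻¹ ∈ K2'} with hE₂
  have hE₁c : IsCompact E₁ := isCompact_setOf_mat_mem W hK1c hK1'c
  have hE₂c : IsCompact E₂ := isCompact_setOf_mat_mem W hK2c hK2'c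
  refine ⟨(fun p : torusFin W × torusFin' W => (((p.1 : torusT W) : GA W), ((p.2 : torusT' W) : GA W))) ⁻¹'
    (E₁ ×ˢ E₂), ?_, ?_⟩
  · -- `T_f ↪ G(𝔸)`, `T′_f ↪ G(𝔸)` are closed embeddings (`isClosed_torusT` + L4-p2's `isClosed_subgroupOf_finitePart`)
    have h1 : Topology.IsClosedEmbedding (fun b : torusFin W => ((b : torusT W) : GA W)) :=
      (Common.isClosed_torusT W).isClosedEmbedding_subtypeVal.comp
        (isClosed_subgroupOf_finitePart W (torusT W)).isClosedEmbedding_subtypeVal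
    have h2 : Topology.IsClosedEmbedding (fun b : torusFin' W => ((b : torusT' W) : GA W)) :=
      (Common.isClosed_torusT' W).isClosedEmbedding_subtypeVal.comp
        (isClosed_subgroupOf_finitePart W (torusT' W)).isClosedEmbedding_subtypeVal
    exact (h1.prodMap h2).isCompact_preimage (hE₁c.prod hE₂c)
  intro p hp
  -- the pair and its data
  set b : GA W := ((p.1 : torusT W) : GA W) with hbdef
  set b' : GA W := ((p.2 : torusT' W) : GA W) with hb'def
  have hpC : b⁻¹ * GA.ofFinPart W (γ₀ : GA W) * b' ∈ C := hp
  have hbT : b ∈ torusT W := (p.1 : torusT W).2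
  have hb'T : b' ∈ torusT' W := (p.2 : torusT' W).2
  have hbf : b ∈ finitePart W := Subgroup.mem_subgroupOf.1 p.1.2
  have hb'f : b' ∈ finitePart W := Subgroup.mem_subgroupOf.1 p.2.2
  obtain ⟨x, y, hb, hn⟩ := exists_torus_data W hΩ hd hΩB hdet hPB hPr hbT
  obtain ⟨x', y', hb', hn'⟩ := exists_torus_data' W hΩ hd hΩB hdet hQB hQr hb'T
  have hbinv := mat_inv_of_decomp W hΩ W.P W.P_comm W.P_idem W.P_sum x y hn hb
  have hb'inv := mat_inv_of_decomp W hΩ W.Q W.Q_comm W.Q_idem W.Q_sum x' y' hn' hb'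
  -- the blocks of `b⁻¹ γ₀ b′` and their coordinates
  have hblock : ∀ i j, finM k (adMat k (W.P i)) * finM k (GA.mat W (b⁻¹ * GA.ofFinPart W (γ₀ : GA W) * b')) *
      finM k (adMat k (W.Q j)) =
      finM k (esc W (x i * x' j + algebraMap k (Ad k) d * (y i * y' j)) (x i * y' j - y i * x' j) * adMat k (W.P i * g₀ * W.Q j)) := by
    intro i j
    rw [finM_mat_ofFinPart_mid, ← finM_mul, ← finM_mul]
    congr 1
    have hbl := block_eq W x (fun i => -y i) x' y' hbinv hb' hg₀.symm hg₀Ω i j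
    have e1 : x i * x' j - algebraMap k (Ad k) d * (-y i * y' j) = x i * x' j + algebraMap k (Ad k) d * (y i * y' j) := by ring
    have e2 : x i * y' j + -y i * x' j = x i * y' j - y i * x' j := by ring
    rw [hbl, esc_mul_esc W hΩ, e1, e2]
  have hKp' : ∀ i, ![finPart k (x i * x' j₁ + algebraMap k (Ad k) d * (y i * y' j₁)), finPart k (x i * y' j₁ - y i * x' j₁)] ∈ Kp i :=
    fun i => hKp i _ hpC _ _ (hblock i j₁)
  have hKq' : ∀ j, ![finPart k (x i₁ * x' j + algebraMap k (Ad k) d * (y i₁ * y' j)), finPart k (x i₁ * y' j - y i₁ * x' j)] ∈ Kq j :=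
    fun j => hKq j _ hpC _ _ (hblock i₁ j)
  -- the normalising central element `z = (esc x′_{j₁} y′_{j₁})_f`
  set E : GA W := escGA W hΩ hΩB (x' j₁) (y' j₁) (hn' j₁) with hE
  set zG : GA W := GA.ofFinPart W E with hzG
  have hzc : zG ∈ centre W := ofFinPart_mem_centre W (escGA_mem_centre W hΩ hΩB _ _ _)
  have hzf : zG ∈ finitePart W := ofFinPart_mem_finitePart' W E
  let zf : torusFin W := ⟨⟨zG, centre_le_torusT W hzc⟩, Subgroup.mem_subgroupOf.2 hzf⟩
  let zf' : torusFin' W := ⟨⟨zG, centre_le_torusT' W hzc⟩, Subgroup.mem_subgroupOf.2 hzf⟩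
  refine ⟨(p.1 * zf⁻¹, p.2 * zf'⁻¹), ?_, (zf, zf'), ⟨zG, hzc, rfl, rfl⟩, ?_⟩
  · -- the normalised pair lies in `C′`
    have hq₁ : (((p.1 * zf⁻¹ : torusFin W) : torusT W) : GA W) = b * zG⁻¹ := rfl
    have hq₂ : (((p.2 * zf'⁻¹ : torusFin' W) : torusT' W) : GA W) = b' * zG⁻¹ := rfl
    refine Set.mem_preimage.2 (Set.mem_prod.2 ⟨?_, ?_⟩)
    · -- `E₁`: `mat (b z⁻¹) ∈ K1`, `mat (b z⁻¹)⁻¹ ∈ K1′`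
      show GA.mat W (b * zG⁻¹) ∈ K1 ∧ GA.mat W (b * zG⁻¹)⁻¹ ∈ K1'
      refine ⟨?_, ?_⟩
      · refine ⟨_, Set.mk_mem_prod (hKp' 0) (hKp' 1), ?_⟩
        exact (mat_mul_ofFinPart_escGA_inv W hΩ hΩB W.P W.P_comm x y hbf hb (x' j₁) (y' j₁) (hn' j₁)).symm
      · refine ⟨_, Set.mk_mem_prod (hKp' 0) (hKp' 1), ?_⟩
        rw [_root_.mul_inv_rev, inv_inv]
        exact (mat_ofFinPart_escGA_mul_inv W hΩ hΩB W.P x y hbf hbinv (x' j₁) (y' j₁) (hn' j₁)).symm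
    · -- `E₂`: `mat (b′ z⁻¹) ∈ K2`, `mat (b′ z⁻¹)⁻¹ ∈ K2′`
      show GA.mat W (b' * zG⁻¹) ∈ K2 ∧ GA.mat W (b' * zG⁻¹)⁻¹ ∈ K2'
      -- the coordinate identities modulo `nrm (x i₁) (y i₁) = 1`
      have hI1 : ∀ j, (x i₁ * x' j + algebraMap k (Ad k) d * (y i₁ * y' j)) * (x i₁ * x' j₁ + algebraMap k (Ad k) d * (y i₁ * y' j₁)) +
          algebraMap k (Ad k) d * ((x i₁ * y' j - y i₁ * x' j) * (x i₁ * y' j₁ - y i₁ * x' j₁)) =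
          x' j * x' j₁ + algebraMap k (Ad k) d * (y' j * y' j₁) := by
        intro j
        have hn₁ := hn i₁
        simp only [nrm] at hn₁
        linear_combination (x' j * x' j₁ + algebraMap k (Ad k) d * (y' j * y' j₁)) * hn₁
      have hI2 : ∀ j, (x i₁ * x' j + algebraMap k (Ad k) d * (y i₁ * y' j)) * (x i₁ * y' j₁ - y i₁ * x' j₁) -
          (x i₁ * y' j - y i₁ * x' j) * (x i₁ * x' j₁ + algebraMap k (Ad k) d * (y i₁ * y' j₁)) =
          x' j * y' j₁ - y' j * x' j₁ := by
        intro j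
        have hn₁ := hn i₁
        simp only [nrm] at hn₁
        linear_combination (x' j * y' j₁ - y' j * x' j₁) * hn₁
      have hμ0 : ∀ j, μc d ![finPart k (x i₁ * x' j + algebraMap k (Ad k) d * (y i₁ * y' j)), finPart k (x i₁ * y' j - y i₁ * x' j)]
          ![finPart k (x i₁ * x' j₁ + algebraMap k (Ad k) d * (y i₁ * y' j₁)), finPart k (x i₁ * y' j₁ - y i₁ * x' j₁)] 0 =
          finPart k (x' j * x' j₁ + algebraMap k (Ad k) d * (y' j * y' j₁)) := by
        intro j
        rw [← hI1 j]
        simp only [μc, Matrix.cons_val_zero, Matrix.cons_val_one, map_add, map_mul, finPart_algebraMap]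
      have hμ1 : ∀ j, μc d ![finPart k (x i₁ * x' j + algebraMap k (Ad k) d * (y i₁ * y' j)), finPart k (x i₁ * y' j - y i₁ * x' j)]
          ![finPart k (x i₁ * x' j₁ + algebraMap k (Ad k) d * (y i₁ * y' j₁)), finPart k (x i₁ * y' j₁ - y i₁ * x' j₁)] 1 =
          -finPart k (x' j * y' j₁ - y' j * x' j₁) := by
        intro j
        rw [← hI2 j]
        simp only [μc, Matrix.cons_val_zero, Matrix.cons_val_one, map_add, map_mul, map_sub, finPart_algebraMap]
      refine ⟨?_, ?_⟩
      · refine ⟨_, Set.mk_mem_prod (Set.mk_mem_prod (hKq' 0) (hKq' 1)) (hKq' j₁), ?_⟩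
        rw [mat_mul_ofFinPart_escGA_inv W hΩ hΩB W.Q W.Q_comm x' y' hb'f hb' (x' j₁) (y' j₁) (hn' j₁)]
        dsimp only [ψQ, ψP]
        rw [hμ0 0, hμ1 0, hμ0 1, hμ1 1]
        simp only [Matrix.cons_val_zero, Matrix.cons_val_one, neg_one_mul, one_mul]
      · refine ⟨_, Set.mk_mem_prod (Set.mk_mem_prod (hKq' 0) (hKq' 1)) (hKq' j₁), ?_⟩
        rw [_root_.mul_inv_rev, inv_inv,
          mat_ofFinPart_escGA_mul_inv W hΩ hΩB W.Q x' y' hb'f hb'inv (x' j₁) (y' j₁) (hn' j₁)]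
        dsimp only [ψQ, ψP]
        rw [hμ0 0, hμ1 0, hμ0 1, hμ1 1]
        simp only [Matrix.cons_val_zero, Matrix.cons_val_one, neg_one_mul, one_mul, neg_neg]
  · -- the product is `p`
    show (p.1 * zf⁻¹ * zf, p.2 * zf'⁻¹ * zf') = p
    rw [inv_mul_cancel_right, inv_mul_cancel_right]

end Main

/-- C-L4-PROPER under the line's binder `hW : IsDefinite W` (the S14602 form): a definite plane has `det B ≠ 0`
(`det_ne_zero_of_isDefinite`, Line1/C7BoxCompact). -/
theorem exists_compact_preimage_subset_mul_diagCentreFin_of_isDefinite (hW : Line1.IsDefinite W)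
    (hg : Line1.IsGenuineRow W) (γ₀ : rationalPoints W) (hreg : Line1.IsLinRegular W γ₀) (C : Set (GA W))
    (hC : IsCompact C) :
    ∃ C' : Set (torusFin W × torusFin' W), IsCompact C' ∧
      {p : torusFin W × torusFin' W |
        (((p.1 : torusT W) : GA W))⁻¹ * GA.ofFinPart W (γ₀ : GA W) * ((p.2 : torusT' W) : GA W) ∈ C} ⊆
        C' * diagCentreFin W :=
  exists_compact_preimage_subset_mul_diagCentreFin W (det_ne_zero_of_isDefinite W hW) hg γ₀ hreg C hC

/-- C-L4-PROPER as the tree's predicate `HasProperFinOrbit` (ProperDefs; binder `hdet : det B ≠ 0`, S14625). -/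
theorem hasProperFinOrbit_of_isLinRegular (hdet : W.B.det ≠ 0) (hg : Line1.IsGenuineRow W) (γ₀ : rationalPoints W)
    (hreg : Line1.IsLinRegular W γ₀) : HasProperFinOrbit W (γ₀ : GA W) :=
  fun C hC => exists_compact_preimage_subset_mul_diagCentreFin W hdet hg γ₀ hreg C hC

/-- C-L4-PROPER as the predicate `HasProperFinOrbit`, under the line's `hW : IsDefinite W`. -/
theorem hasProperFinOrbit_of_isDefinite (hW : Line1.IsDefinite W) (hg : Line1.IsGenuineRow W) (γ₀ : rationalPoints W)
    (hreg : Line1.IsLinRegular W γ₀) : HasProperFinOrbit W (γ₀ : GA W) :=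
  hasProperFinOrbit_of_isLinRegular W (det_ne_zero_of_isDefinite W hW) hg γ₀ hreg

end Summit.Ventures.HodgeRepro.Tier4.Line4

end
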